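import Summits.CriticalPhenomena.CardyFormulaZ2.Theorems.CardyRotToConfR2SymmetryUpgrade.Negative.SurgFatFamily
import Summits.CriticalPhenomena.CardyFormulaZ2.Theorems.CardyRotToConfR2SymmetryUpgrade.Negative.SurgSlitTopology
import Summits.CriticalPhenomena.CardyFormulaZ2.Theorems.CardyRotToConfR2SymmetryUpgrade.Negative.MarkovRenewal
import Literature.Probability.RandomPlanarGeometry.ChordalRestrictionMarkov
import HarnessLib

/-!
# The Markov kernel of the fat-germ one-shot surgery
# (crux `CardyRotToConfR2SymmetryUpgrade`, stmt-CriticalPhenomena-0698, line germ-label-transport)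

The typed domain Markov property asks for a kernel that is a FUNCTION OF THE TRIPLE
(remaining domain `V`, tip `z`, target `b`). For the surgery `fatSurgery S` of an admissible
family `S` with Markov extension `Q` we define `surgKernel S Q V z b` by cases on the triple:

* `IsJordanConfig V z b` — `V` is the carrier of a Dobrushin domain `(V; z, b)`: the surgery's own
  law there (forced by `initial` + `domain`);
* `IsSlitConfig V z b` — `V = D₁ ∖ [a₁, z]` for a firing `D₁` with target `b` and an open point `z`
  of its chord: the surgery law of `D₁` restarted at `z` (the curve is in the middle of its chord);
* `z = b` — the Dirac mass at the constant curve at `b`;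
* `IsRealizable V z b` — the triple is `(remainingDomain D' p, p.target, D'.pt 1)` for some
  `(D', p)`: the value `Q D' p` (well defined by `Q`'s `domain` clause);
* otherwise `0`.

`surgExt S Q D past := surgKernel S Q (remainingDomain D past) past.target (D.pt 1)` is then a
candidate Markov extension: `domain` holds by construction and `initial` by `fatSurgery_congr`.
Main statements: the evaluation lemmas `surgKernel_of_jordan`, `surgKernel_of_slit`,
`surgKernel_of_target`, `surgKernel_of_realizable`, the decoding lemma `eq_of_slit_eq`
(a slit configuration determines the carrier and the base point), `surgExt_initial`,
`surgExt_domain`. Negative lane: no Theses statement is asserted.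
-/

noncomputable section

open Set Filter Topology Metric MeasureTheory
open scoped unitInterval

namespace Summit.CriticalPhenomena.CardyFormulaZ2.Theorems.CardyRotToConfR2SymmetryUpgrade.Negative

open Literature.Probability.RandomPlanarGeometry Literature.Probability.RandomPlanarGeometry.ChordalFamily

/-! ### The three kinds of special triples -/

/-- `(V; z, b)` is a Dobrushin configuration: `V` is the carrier of a Dobrushin domain with marked
points `z`, `b`. [folklore] -/
def IsJordanConfig (V : Set ℂ) (z b : ℂ) : Prop :=
  ∃ D₂ : DobrushinDomain, D₂.carrier = V ∧ D₂.pt 0 = z ∧ D₂.pt 1 = b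

/-- `(V; z, b)` is a mid-chord configuration of the surgery: `V = D₁ ∖ [a₁, z]` for a firing
Dobrushin domain `D₁` with target `b` and a point `z` of its open chord. [folklore] -/
def IsSlitConfig (V : Set ℂ) (z b : ℂ) : Prop :=
  ∃ D₁ : DobrushinDomain, ∃ s : I, Fires D₁.carrier (D₁.pt 0) ∧ D₁.pt 1 = b ∧ 0 < (s : ℝ) ∧ (s : ℝ) < 1 ∧
    fireChord D₁ s = z ∧ V = D₁.carrier \ segment ℝ (D₁.pt 0) z

/-- `(V; z, b)` is realised as (remaining domain, tip, target) of some explored past. [folklore] -/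
def IsRealizable (V : Set ℂ) (z b : ℂ) : Prop :=
  ∃ D' : DobrushinDomain, ∃ p : CurveClass ℂ, remainingDomain D' p = V ∧ p.target = z ∧ D'.pt 1 = b

/-! ### The kernel -/

variable (S : ChordalFamily) (Q : DobrushinDomain → CurveClass ℂ → Measure (CurveClass ℂ))

/-- **The surgery's Markov kernel as a function of (remaining domain, tip, target).** [folklore] -/
def surgKernel (V : Set ℂ) (z b : ℂ) : Measure (CurveClass ℂ) :=
  open scoped Classical in
  if h₁ : IsJordanConfig V z b then fatSurgery S h₁.choose
  else if h₂ : IsSlitConfig V z b then (fatSurgery S h₂.choose).map (CurveClass.startFrom {z})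
  else if z = b then Measure.dirac (CurveClass.mk (Curve.const b))
  else if h₄ : IsRealizable V z b then Q h₄.choose h₄.choose_spec.choose
  else 0

/-- **The candidate Markov extension of the surgery.** [folklore] -/
def surgExt : DobrushinDomain → CurveClass ℂ → Measure (CurveClass ℂ) := fun D past =>
  surgKernel S Q (remainingDomain D past) past.target (D.pt 1)

variable {S Q}

/-! ### Points of the chord and the slit decoding -/

section Slit

variable {D₁ : DobrushinDomain} (h : Fires D₁.carrier (D₁.pt 0))
include h

/-- The initial closed piece `[a, chord s]` of the chord minus `a` lies in `D₁`, for `s < 1`.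
[folklore] -/
theorem segment_fireChord_diff_subset {s : I} (hs1 : (s : ℝ) < 1) :
    segment ℝ (D₁.pt 0) (fireChord D₁ s) \ {D₁.pt 0} ⊆ D₁.carrier := by
  rintro z ⟨hz, hza⟩
  rw [segment_eq_image_lineMap] at hz
  obtain ⟨θ, hθ, rfl⟩ := hz
  have hθ0 : 0 < θ := by
    refine lt_of_le_of_ne hθ.1 ?_
    rintro rfl
    exact hza (by simp)
  -- `lineMap a (chord s) θ = rayPt a m (θ s τ)`
  have e : AffineMap.lineMap (D₁.pt 0) (fireChord D₁ s) θ = rayPt (D₁.pt 0) (fireTip D₁) (θ * ((s : ℝ) * fireExit D₁)) := by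
    rw [AffineMap.lineMap_apply_module, fireChord_apply, rayPt, rayPt]
    simp only [Complex.real_smul]
    push_cast
    ring
  rw [e]
  have hτ := fireExit_pos h
  have hs0 : 0 < (s : ℝ) := by
    by_contra hle
    have : (s : ℝ) = 0 := le_antisymm (not_lt.1 hle) s.2.1
    apply hza
    rw [mem_singleton_iff, AffineMap.lineMap_apply_module, fireChord_apply, this, zero_mul, rayPt_zero]
    module
  refine rayPt_mem_carrier (by positivity) ?_
  calc θ * ((s : ℝ) * fireExit D₁) ≤ 1 * ((s : ℝ) * fireExit D₁) := by gcongr; exact hθ.2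
    _ = (s : ℝ) * fireExit D₁ := one_mul _
    _ < 1 * fireExit D₁ := by gcongr
    _ = fireExit D₁ := one_mul _

/-- An open chord point differs from `a`. [folklore] -/
theorem fireChord_ne_pt_zero {s : I} (hs0 : 0 < (s : ℝ)) : fireChord D₁ s ≠ D₁.pt 0 := by
  rw [Ne, fireChord_eq_pt_zero_iff h]
  intro hs
  rw [hs] at hs0
  exact lt_irrefl _ hs0

/-- A mid-chord configuration is not a Dobrushin configuration (a slit domain is not a Jordan
carrier). [folklore] -/
theorem not_isJordanConfig_of_slit {s : I} (hs0 : 0 < (s : ℝ)) (hs1 : (s : ℝ) < 1) {b : ℂ} :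
    ¬ IsJordanConfig (D₁.carrier \ segment ℝ (D₁.pt 0) (fireChord D₁ s)) (fireChord D₁ s) b := by
  rintro ⟨D₂, hD₂, -, -⟩
  exact not_exists_carrier_eq_diff_segment D₁.toJordanDomain (fireChord_ne_pt_zero h hs0).symm
    (segment_fireChord_diff_subset h hs1) ⟨D₂.toJordanDomain, hD₂⟩

end Slit

/-- Two closed segments with a common endpoint `z`, each containing the other's far endpoint,
coincide: `a ∈ [a', z]` and `a' ∈ [a, z]` force `a = a'`. [folklore] -/
theorem eq_of_mem_segment_of_mem_segment {a a' z : ℂ} (ha : a ∈ segment ℝ a' z) (ha' : a' ∈ segment ℝ a z) :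
    a = a' := by
  rw [segment_eq_image_lineMap] at ha ha'
  obtain ⟨t, ht, hta⟩ := ha
  obtain ⟨t', ht', hta'⟩ := ha'
  rw [AffineMap.lineMap_apply_module] at hta hta'
  -- `a - z = (1 - t) (a' - z)` and `a' - z = (1 - t') (a - z)`
  have e1 : a - z = (1 - t) • (a' - z) := by rw [← hta]; module
  have e2 : a' - z = (1 - t') • (a - z) := by rw [← hta']; module
  have e3 : a - z = ((1 - t) * (1 - t')) • (a - z) := by rw [mul_smul, ← e2, ← e1]
  rcases eq_or_ne (a - z) 0 with h0 | h0
  · have : a' - z = 0 := by rw [e2, h0, smul_zero]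
    rw [sub_eq_zero] at h0 this
    rw [h0, this]
  · have hprod : (1 - t) * (1 - t') = 1 := by
      have := congrArg (fun w => w - ((1 - t) * (1 - t')) • (a - z)) e3
      simp only [sub_self] at this
      have e4 : (1 - (1 - t) * (1 - t')) • (a - z) = 0 := by rw [sub_smul, one_smul]; exact this
      rcases smul_eq_zero.1 e4 with h | h
      · linarith
      · exact absurd h h0
    have ht1 : 1 - t = 1 := by nlinarith [ht.1, ht.2, ht'.1, ht'.2]
    have : t = 0 := by linarith
    subst this
    simp at hta
    exact hta.symm

/-- **Slit decoding.** A mid-chord configuration determines the carrier and the base point: if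
`D₁ ∖ [a₁, z] = D₁' ∖ [a₁', z]` for firing domains with `z` on both open chords, then the carriers
and the base points coincide. [folklore] -/
theorem eq_of_slit_eq {D₁ D₁' : DobrushinDomain} (h : Fires D₁.carrier (D₁.pt 0))
    (h' : Fires D₁'.carrier (D₁'.pt 0)) {s s' : I} (hs0 : 0 < (s : ℝ)) (hs1 : (s : ℝ) < 1)
    (hs0' : 0 < (s' : ℝ)) (hs1' : (s' : ℝ) < 1) {z : ℂ} (hz : fireChord D₁ s = z) (hz' : fireChord D₁' s' = z)
    (hV : D₁.carrier \ segment ℝ (D₁.pt 0) z = D₁'.carrier \ segment ℝ (D₁'.pt 0) z) :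
    D₁.carrier = D₁'.carrier ∧ D₁.pt 0 = D₁'.pt 0 := by
  have hza : z ≠ D₁.pt 0 := hz ▸ fireChord_ne_pt_zero h hs0
  have hza' : z ≠ D₁'.pt 0 := hz' ▸ fireChord_ne_pt_zero h' hs0'
  have hsub : segment ℝ (D₁.pt 0) z \ {D₁.pt 0} ⊆ D₁.carrier := hz ▸ segment_fireChord_diff_subset h hs1
  have hsub' : segment ℝ (D₁'.pt 0) z \ {D₁'.pt 0} ⊆ D₁'.carrier := hz' ▸ segment_fireChord_diff_subset h' hs1'
  have hc : D₁.carrier = D₁'.carrier :=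
    carrier_eq_of_diff_eq (D := D₁.toJordanDomain) (D' := D₁'.toJordanDomain)
      (interior_segment_eq_empty hza.symm) (interior_segment_eq_empty hza'.symm) hV
  refine ⟨hc, ?_⟩
  -- the two punctured segments are the parts of the segments inside the common carrier
  have hin : segment ℝ (D₁.pt 0) z ∩ D₁.carrier = segment ℝ (D₁'.pt 0) z ∩ D₁.carrier := by
    have e1 : segment ℝ (D₁.pt 0) z ∩ D₁.carrier = D₁.carrier \ (D₁.carrier \ segment ℝ (D₁.pt 0) z) := by
      ext w; constructor
      · rintro ⟨hw1, hw2⟩; exact ⟨hw2, fun hh => hh.2 hw1⟩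
      · rintro ⟨hw1, hw2⟩; exact ⟨by_contra fun hh => hw2 ⟨hw1, hh⟩, hw1⟩
    have e2 : segment ℝ (D₁'.pt 0) z ∩ D₁.carrier = D₁.carrier \ (D₁'.carrier \ segment ℝ (D₁'.pt 0) z) := by
      ext w; constructor
      · rintro ⟨hw1, hw2⟩; exact ⟨hw2, fun hh => hh.2 hw1⟩
      · rintro ⟨hw1, hw2⟩
        refine ⟨by_contra fun hh => hw2 ⟨hc ▸ hw1, hh⟩, hw1⟩
    rw [e1, e2, hV]
  have hpa : D₁.pt 0 ∉ D₁.carrier := fun hh => by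
    have := D₁.pt_mem_frontier 0; rw [D₁.isOpen.frontier_eq] at this; exact this.2 hh
  have hpa' : D₁'.pt 0 ∉ D₁.carrier := fun hh => by
    have := D₁'.pt_mem_frontier 0; rw [D₁'.isOpen.frontier_eq, ← hc] at this; exact this.2 hh
  have hseg : segment ℝ (D₁.pt 0) z \ {D₁.pt 0} = segment ℝ (D₁'.pt 0) z \ {D₁'.pt 0} := by
    have e1 : segment ℝ (D₁.pt 0) z \ {D₁.pt 0} = segment ℝ (D₁.pt 0) z ∩ D₁.carrier := by
      ext w; constructor
      · intro hw; exact ⟨hw.1, hsub hw⟩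
      · rintro ⟨hw1, hw2⟩; exact ⟨hw1, fun hh => hpa (mem_singleton_iff.1 hh ▸ hw2)⟩
    have e2 : segment ℝ (D₁'.pt 0) z \ {D₁'.pt 0} = segment ℝ (D₁'.pt 0) z ∩ D₁.carrier := by
      ext w; constructor
      · intro hw; exact ⟨hw.1, hc ▸ hsub' hw⟩
      · rintro ⟨hw1, hw2⟩; exact ⟨hw1, fun hh => hpa' (mem_singleton_iff.1 hh ▸ hw2)⟩
    rw [e1, e2, hin]
  -- closures recover the far endpoints
  have hsegcl : ∀ x y : ℂ, IsClosed (segment ℝ x y) := fun x y => by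
    rw [segment_eq_image_lineMap]; exact (isCompact_Icc.image AffineMap.lineMap_continuous).isClosed
  have key : ∀ {x x' : ℂ}, x' ≠ z → segment ℝ x z \ {x} = segment ℝ x' z \ {x'} → x' ∈ segment ℝ x z := by
    intro x x' hx'z hxx'
    have h1 : x' ∈ closure (openSegment ℝ x' z) := segment_subset_closure_openSegment (left_mem_segment ℝ x' z)
    have h2 : openSegment ℝ x' z ⊆ segment ℝ x z \ {x} := by
      rw [hxx']
      intro w hw
      refine ⟨openSegment_subset_segment ℝ _ _ hw, fun hwx => hx'z ?_⟩
      rw [mem_singleton_iff] at hwx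
      rw [hwx] at hw
      exact (left_mem_openSegment_iff.1 hw)
    exact closure_minimal (h2.trans sdiff_subset) (hsegcl x z) h1
  have ha' : D₁'.pt 0 ∈ segment ℝ (D₁.pt 0) z := key hza'.symm hseg
  have ha : D₁.pt 0 ∈ segment ℝ (D₁'.pt 0) z := key hza.symm hseg.symm
  exact eq_of_mem_segment_of_mem_segment ha ha'

/-! ### Evaluation of the kernel -/

section Eval

variable {V : Set ℂ} {z b : ℂ}

/-- **On Dobrushin configurations the kernel is the surgery's own law** (any Dobrushin structure
with that carrier and marks; `S` local). [folklore] -/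
theorem surgKernel_of_jordan (hS : S.IsLocal) {D₂ : DobrushinDomain} (hV : D₂.carrier = V)
    (h0 : D₂.pt 0 = z) (h1 : D₂.pt 1 = b) : surgKernel S Q V z b = fatSurgery S D₂ := by
  have h₁ : IsJordanConfig V z b := ⟨D₂, hV, h0, h1⟩
  rw [surgKernel, dif_pos h₁]
  obtain ⟨hc, hc0, hc1⟩ := h₁.choose_spec
  exact fatSurgery_congr hS (hc.trans hV.symm) (hc0.trans h0.symm) (hc1.trans h1.symm)

/-- **On mid-chord configurations the kernel is the surgery law restarted at the tip.** [folklore] -/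
theorem surgKernel_of_slit (hS : S.IsLocal) {D₁ : DobrushinDomain} (h : Fires D₁.carrier (D₁.pt 0))
    {s : I} (hs0 : 0 < (s : ℝ)) (hs1 : (s : ℝ) < 1) (hz : fireChord D₁ s = z) (hb : D₁.pt 1 = b)
    (hV : V = D₁.carrier \ segment ℝ (D₁.pt 0) z) :
    surgKernel S Q V z b = (fatSurgery S D₁).map (CurveClass.startFrom {z}) := by
  have hnJ : ¬ IsJordanConfig V z b := by rw [hV, ← hz]; exact not_isJordanConfig_of_slit h hs0 hs1
  have h₂ : IsSlitConfig V z b := ⟨D₁, s, h, hb, hs0, hs1, hz, hV⟩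
  rw [surgKernel, dif_neg hnJ, dif_pos h₂]
  obtain ⟨s', hF', hb', hs0', hs1', hz', hV'⟩ := h₂.choose_spec
  obtain ⟨hc, hc0⟩ := eq_of_slit_eq hF' h hs0' hs1' hs0 hs1 hz' hz (hV'.symm.trans hV)
  rw [fatSurgery_congr hS hc hc0 (hb'.trans hb.symm)]

/-- **At tips equal to the target (and no special configuration) the kernel is `δ_{const b}`.**
[folklore] -/
theorem surgKernel_of_target (hnJ : ¬ IsJordanConfig V z b) (hnS : ¬ IsSlitConfig V z b) (hz : z = b) :
    surgKernel S Q V z b = Measure.dirac (CurveClass.mk (Curve.const b)) := by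
  rw [surgKernel, dif_neg hnJ, dif_neg hnS, if_pos hz]

/-- **On realizable configurations (and no special configuration, tip off the target) the kernel
is `Q` at any realization.** [folklore] -/
theorem surgKernel_of_realizable (hQ : S.IsMarkovExtension Q) (hnJ : ¬ IsJordanConfig V z b)
    (hnS : ¬ IsSlitConfig V z b) (hz : z ≠ b) {D' : DobrushinDomain} {p : CurveClass ℂ}
    (hrem : remainingDomain D' p = V) (ht : p.target = z) (hb : D'.pt 1 = b) :
    surgKernel S Q V z b = Q D' p := by
  have h₄ : IsRealizable V z b := ⟨D', p, hrem, ht, hb⟩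
  rw [surgKernel, dif_neg hnJ, dif_neg hnS, if_neg hz, dif_pos h₄]
  obtain ⟨hrem', ht', hb'⟩ := h₄.choose_spec.choose_spec
  exact hQ.domain _ _ _ _ (hrem'.trans hrem.symm) (ht'.trans ht.symm) (hb'.trans hb.symm)

end Eval

/-! ### `initial` and `domain` for the candidate extension -/

/-- **`initial`**: with nothing explored the candidate extension is the surgery law. [folklore] -/
theorem surgExt_initial (hS : S.IsLocal) (D : DobrushinDomain) :
    surgExt S Q D (CurveClass.mk (Curve.const (D.pt 0))) = fatSurgery S D := by
  rw [surgExt, remainingDomain_mk_const]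
  exact surgKernel_of_jordan hS rfl (by rw [CurveClass.target_mk, Curve.target_def, Curve.const_apply]) rfl

/-- **`domain`**: the candidate extension is a function of (remaining domain, tip, target).
[folklore] -/
theorem surgExt_domain (D₁ D₂ : DobrushinDomain) (p₁ p₂ : CurveClass ℂ)
    (hrem : remainingDomain D₁ p₁ = remainingDomain D₂ p₂) (ht : p₁.target = p₂.target)
    (hb : D₁.pt 1 = D₂.pt 1) : surgExt S Q D₁ p₁ = surgExt S Q D₂ p₂ := by
  rw [surgExt, surgExt, hrem, ht, hb]

end Summit.CriticalPhenomena.CardyFormulaZ2.Theorems.CardyRotToConfR2SymmetryUpgrade.Negative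

end
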